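import Literature.Analysis.FluidPDE.GeneralStrongBeltramiFlows
import HarnessLib

/-!
# Strong Beltrami flows from finitely many eigenvectors: Prop. 2.13 with an atomic measure
# (Majda–Bertozzi 2002, §2.3.2 Proposition 2.13, eq. (2.50); Prop. 2.12 / Example 2.8; p. 61)

Literature file (topic `Analysis/FluidPDE`), companion of `GeneralStrongBeltramiFlows`: A. J. Majda,
A. L. Bertozzi, *Vorticity and Incompressible Flow* (CUP 2002), §2.3.2, pp. 60–61 (PDF pp. 55–56).
MB obtain Prop. 2.13 by "integrating `v_e(x) = e^{iλx·k}ω_e(k)` over the unit sphere" against an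
arbitrary (complex) measure; the finite superpositions of Prop. 2.12 / Example 2.8 (e.g. the ABC
flow, six unit wave vectors `±e_i`) are the case of an ATOMIC measure `μ = Σ_{j∈s} δ_{k_j}`. This
file records that case of the tree's `StrongBeltrami.velocity` (the field (2.50)) explicitly —
no integrability or measurability hypotheses survive, only MB's two eigenvector equations at the
finitely many atoms. All statements are theorems; no definitions; no named facts.

* `StrongBeltrami.dot_eq_zero_of_eigen` — `ik × a = a ⇒ k · a = 0` (the first eigenvector equation
  implies the second, since `k · (k × b) = 0`);
* `StrongBeltrami.velocity_sum_dirac` — for `μ = Σ_{j∈s} δ_{k_j}`,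
  `v(x) = Σ_{j∈s} (conj + id)(e^{iλ̄x·k_j} a(k_j))` (Bochner integral against a finite sum of Dirac
  masses); **`velocity_sum_dirac_eq_abc`** — Example 2.8 recovered: with `μ = δ_{e₁} + δ_{e₂} + δ_{e₃}`,
  `N(k) = (k₃, k₁, k₂)`, `A(k) = −(i/2)(A k₃ + B k₁ + C k₂)` and `λ̄ = 1`, the field (2.50) is
  literally the tree's ABC flow `ABC.abc A B C` of `BeltramiFlows` ((2.49));
* `isBeltrami_velocity_sum_dirac` (`curl v = λ̄v` when `|k_j| = 1`, `ik_j × a(k_j) = a(k_j)`),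
  `isDivFree_velocity_sum_dirac`, `contDiff_velocity_sum_dirac`,
  `isClassicalEulerSolutionOn_velocity_sum_dirac` (Prop. 2.10),
  `isClassicalNSSolutionOn_velocity_sum_dirac` (p. 61: `e^{−λ̄²νt}v`).

HONEST FRAMING (cell `pub-fluidc`): typed infrastructure for a low prior, high
value-of-information experiment on Tao's machine paradigm; NOT a claim that NS blows up. Reading
for the cell: single-shell Beltrami superpositions are exact `e^{−λ̄²νt}`-decaying Navier–Stokes
solutions with no nonlinear transfer — zero-cost engine checks.

## References

* [MajdaBertozziCUP2002] A. J. Majda, A. L. Bertozzi, Vorticity and Incompressible Flow, CUP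
  2002, §2.3.2 Prop. 2.13 eq. (2.50), Prop. 2.12, Example 2.8, p. 61.
-/

noncomputable section

open Real Set Function MeasureTheory Complex WithLp InnerProductSpace
open scoped RealInnerProductSpace ContDiff Topology Matrix


namespace Literature.Analysis.FluidPDE

namespace StrongBeltrami

open KY (cplx dot)
open MeasureTheory Complex WithLp

section ModeSums

/-- `ik × a = a` forces `k · a = 0` (`k · (k × b) = 0`): MB's first eigenvector equation implies the
second. [cite: MajdaBertozziCUP2002, §2.3.2 Prop. 2.13 (derivation, pp. 60–61)] -/
theorem dot_eq_zero_of_eigen {k : Fin 3 → ℝ} {w : Fin 3 → ℂ} (h : I • (cplx k ⨯₃ w) = w) :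
    dot (cplx k) w = 0 := by
  rw [← h, KY.dot_smul_right, KY.dot_eq_dotProduct, dot_self_cross, mul_zero]

variable {ι : Type*} (s : Finset ι) (k : ι → EuclideanSpace ℝ (Fin 3))

/-- Every function is integrable against a Dirac mass. [folklore] -/
private theorem integrable_dirac' {G : Type*} [NormedAddCommGroup G]
    (g : EuclideanSpace ℝ (Fin 3) → G) (b : EuclideanSpace ℝ (Fin 3)) :
    Integrable g (Measure.dirac b) :=
  (integrable_const (g b)).congr (ae_eq_dirac g).symm

/-- A property holding at every atom holds a.e. for a finite sum of Dirac masses. [folklore] -/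
private theorem ae_sum_dirac {P : EuclideanSpace ℝ (Fin 3) → Prop} (h : ∀ j ∈ s, P (k j)) :
    ∀ᵐ x ∂(∑ j ∈ s, Measure.dirac (k j)), P x := by
  classical
  induction s using Finset.induction_on with
  | empty => simp
  | insert j t hj ih =>
    rw [Finset.sum_insert hj, ae_add_measure_iff]
    refine ⟨?_, ih fun i hi => h i (Finset.mem_insert_of_mem hi)⟩
    rw [ae_dirac_eq]
    exact Filter.eventually_pure.2 (h j (Finset.mem_insert_self j t))

/-- Every function is integrable against a finite sum of Dirac masses. [folklore] -/
private theorem integrable_sum_dirac {G : Type*} [NormedAddCommGroup G]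
    (g : EuclideanSpace ℝ (Fin 3) → G) : Integrable g (∑ j ∈ s, Measure.dirac (k j)) :=
  integrable_finsetSum_measure.2 fun j _ => integrable_dirac' g (k j)

variable (lam : ℝ) (a : EuclideanSpace ℝ (Fin 3) → (Fin 3 → ℂ))

/-- **Finitely many eigenvectors** (Prop. 2.13 with the atomic measure `μ = Σ_{j∈s} δ_{k_j}`): the
field (2.50) is the finite superposition `v(x) = Σ_{j∈s} (conj + id)(e^{iλ̄x·k_j} a(k_j))`.
[cite: MajdaBertozziCUP2002, §2.3.2 Prop. 2.13 eq. (2.50)] -/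
theorem velocity_sum_dirac (x : EuclideanSpace ℝ (Fin 3)) :
    velocity lam (∑ j ∈ s, Measure.dirac (k j)) a x =
      ∑ j ∈ s, twoRe (cexp (↑(lam * ⟪x, k j⟫_ℝ) * I) • a (k j)) := by
  rw [velocity, modeIntegral_eq_integral_cexp,
    integral_finsetSum_measure fun j _ => integrable_dirac' _ (k j)]
  simp_rw [integral_dirac]
  rw [map_sum]


/-- The three atomic amplitudes of the ABC flow: at `e₁`, `e₂`, `e₃` the density
`−(i/2)(A k₃ + B k₁ + C k₂)` and the tangent field `N(k) = (k₃, k₁, k₂)` give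
`−(iB/2)(0, 1, i)`, `−(iC/2)(i, 0, 1)`, `−(iA/2)(1, i, 0)`. [cite: MajdaBertozziCUP2002, §2.3.2 Example 2.8 eq. (2.49)] -/
private theorem amplitude_abc_atoms (A B C : ℝ) :
    (amplitude (fun k => -(I / 2) * ↑(A * k 2 + B * k 0 + C * k 1)) (fun k => !₂[k 2, k 0, k 1])
        (EuclideanSpace.single 0 (1 : ℝ)) = (-(I / 2) * B) • ![0, 1, I]) ∧
    (amplitude (fun k => -(I / 2) * ↑(A * k 2 + B * k 0 + C * k 1)) (fun k => !₂[k 2, k 0, k 1])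
        (EuclideanSpace.single 1 (1 : ℝ)) = (-(I / 2) * C) • ![I, 0, 1]) ∧
    (amplitude (fun k => -(I / 2) * ↑(A * k 2 + B * k 0 + C * k 1)) (fun k => !₂[k 2, k 0, k 1])
        (EuclideanSpace.single 2 (1 : ℝ)) = (-(I / 2) * A) • ![1, I, 0]) := by
  refine ⟨?_, ?_, ?_⟩ <;>
  · rw [KY.vec3_eq_iff]
    simp [amplitude, modeVector, cross_apply, KY.cplx_apply, Matrix.vecHead, Matrix.vecTail]

/-- **Example 2.8 inside Proposition 2.13 — the ABC flow is the field (2.50) of an atomic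
measure**: with `μ = δ_{e₁} + δ_{e₂} + δ_{e₃}` (three points of the unit sphere), the tangent unit
field `N(k) = (k₃, k₁, k₂)` and the density `A(k) = −(i/2)(A k₃ + B k₁ + C k₂)`, the field (2.50)
with `λ̄ = 1` IS the Arnold–Beltrami–Childress flow
`(A sin x₃ + C cos x₂, B sin x₁ + A cos x₃, C sin x₂ + B cos x₁)` of `BeltramiFlows` (MB: "by
Proposition 2.12 the 3D B flow is given by … the famous ABC flow (2.49)"; Prop. 2.12's eigenmode
sums are Prop. 2.13 with atomic `μ`). [cite: MajdaBertozziCUP2002, §2.3.2 Example 2.8 eq. (2.49) with Prop. 2.13 eq. (2.50)] -/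
theorem velocity_sum_dirac_eq_abc (A B C : ℝ) :
    velocity 1 (∑ j : Fin 3, Measure.dirac (EuclideanSpace.single j (1 : ℝ)))
        (amplitude (fun k => -(I / 2) * ↑(A * k 2 + B * k 0 + C * k 1))
          (fun k => !₂[k 2, k 0, k 1])) = ABC.abc A B C := by
  funext x
  obtain ⟨h0, h1, h2⟩ := amplitude_abc_atoms A B C
  rw [velocity_sum_dirac, Fin.sum_univ_three, h0, h1, h2]
  simp only [EuclideanSpace.inner_single_right, conj_trivial, one_mul]
  have e : ∀ r : ℝ, -(I / 2) * (r : ℂ) = ((-(r / 2) : ℝ) : ℂ) * I := fun r => by push_cast; ring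
  simp only [e]
  ext i
  fin_cases i <;>
    simp [Complex.mul_re, Complex.mul_im, Complex.exp_ofReal_mul_I_re,
      Complex.exp_ofReal_mul_I_im] <;> ring

variable {s k a}

/-- **Prop. 2.13, finitely many modes — strong Beltrami**: for unit wave vectors `k_j` and
eigenvectors `a(k_j)` with `i k_j × a(k_j) = a(k_j)`, the superposition is a strong Beltrami field
(`curl v = λ̄ v`); this is how Prop. 2.12 / Example 2.8 sit inside Prop. 2.13.
[cite: MajdaBertozziCUP2002, §2.3.2 Prop. 2.13 eq. (2.50)] -/
theorem isBeltrami_velocity_sum_dirac (hk : ∀ j ∈ s, ‖k j‖ = 1)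
    (heig : ∀ j ∈ s, I • (cplx (ofLp (k j)) ⨯₃ a (k j)) = a (k j)) :
    IsBeltrami (velocity lam (∑ j ∈ s, Measure.dirac (k j)) a) fun _ => lam :=
  isBeltrami_velocity lam (ae_sum_dirac s k hk) (integrable_sum_dirac s k a) (ae_sum_dirac s k heig)

/-- **Prop. 2.13, finitely many modes — divergence free** (`k_j · a(k_j) = 0`).
[cite: MajdaBertozziCUP2002, §2.3.2 Prop. 2.13 eq. (2.50)] -/
theorem isDivFree_velocity_sum_dirac (hk : ∀ j ∈ s, ‖k j‖ = 1)
    (hdot : ∀ j ∈ s, dot (cplx (ofLp (k j))) (a (k j)) = 0) :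
    VectorCalculus.IsDivFree (velocity lam (∑ j ∈ s, Measure.dirac (k j)) a) :=
  isDivFree_velocity lam (ae_sum_dirac s k hk) (integrable_sum_dirac s k a) (ae_sum_dirac s k hdot)

/-- **Prop. 2.13, finitely many modes — smoothness.** [cite: MajdaBertozziCUP2002, §2.3.2 Prop. 2.13 eq. (2.50)] -/
theorem contDiff_velocity_sum_dirac (hk : ∀ j ∈ s, ‖k j‖ = 1) :
    ContDiff ℝ ∞ (velocity lam (∑ j ∈ s, Measure.dirac (k j)) a) :=
  contDiff_velocity lam (ae_sum_dirac s k hk) (integrable_sum_dirac s k a)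

/-- **Prop. 2.13 with Prop. 2.10, finitely many modes**: the superposition with pressure `−½|v|²`
is a steady classical Euler solution on `ℝ³ × ℝ`. [cite: MajdaBertozziCUP2002, §2.3.2 Prop. 2.13 with Prop. 2.10] -/
theorem isClassicalEulerSolutionOn_velocity_sum_dirac (hk : ∀ j ∈ s, ‖k j‖ = 1)
    (heig : ∀ j ∈ s, I • (cplx (ofLp (k j)) ⨯₃ a (k j)) = a (k j)) :
    IsClassicalEulerSolutionOn univ 0 (fun _ => velocity lam (∑ j ∈ s, Measure.dirac (k j)) a)
      (fun _ x => -(‖velocity lam (∑ j ∈ s, Measure.dirac (k j)) a x‖ ^ 2 / 2)) := by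
  exact (isBeltrami_velocity_sum_dirac lam hk heig).isClassicalEulerSolutionOn
    (contDiff_velocity_sum_dirac lam hk)
    (isDivFree_velocity_sum_dirac lam hk fun j hj => dot_eq_zero_of_eigen (heig j hj))

/-- **p. 61, finitely many modes — exact viscous decay**: `e^{−λ̄²νt} v` (pressure
`−½e^{−2λ̄²νt}|v|²`) is a classical Navier–Stokes solution on `ℝ³ × ℝ` for every `ν`.
[cite: MajdaBertozziCUP2002, §2.3.2 p. 61 (after Prop. 2.13)] -/
theorem isClassicalNSSolutionOn_velocity_sum_dirac (ν : ℝ) (hk : ∀ j ∈ s, ‖k j‖ = 1)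
    (heig : ∀ j ∈ s, I • (cplx (ofLp (k j)) ⨯₃ a (k j)) = a (k j)) :
    IsClassicalNSSolutionOn univ ν 0
      (strongBeltramiVelocity ν lam (velocity lam (∑ j ∈ s, Measure.dirac (k j)) a))
      (strongBeltramiPressure ν lam (velocity lam (∑ j ∈ s, Measure.dirac (k j)) a)) :=
  isClassicalNSSolutionOn_strongBeltrami ν (isBeltrami_velocity_sum_dirac lam hk heig)
    (contDiff_velocity_sum_dirac lam hk)
    (isDivFree_velocity_sum_dirac lam hk fun j hj => dot_eq_zero_of_eigen (heig j hj))

end ModeSums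

end StrongBeltrami

end Literature.Analysis.FluidPDE
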